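import Summits.BirchSwinnertonDyer.BirchSwinnertonDyer.Theses.GenusKolyvaginAtTwo
import Summits.BirchSwinnertonDyer.BirchSwinnertonDyer.Theorems.GenusKolyvaginAtTwoMinimalTwinBSDTwoSwappedPairDescent
import Summits.BirchSwinnertonDyer.BirchSwinnertonDyer.Theorems.GenusKolyvaginAtTwoGenusPrimitiveSupplyAtTwoTwinConverse
import Summits.BirchSwinnertonDyer.BirchSwinnertonDyer.Theorems.GenusKolyvaginAtTwoGenusDeepSupplyAtTwoNegDiscNarrowOfKernels
import Literature.NumberTheory.EllipticCurves.KrizLi2019.AssumptionStarTwoPrimitiveProofs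
import Literature.NumberTheory.EllipticCurves.BoxerDiao2010.TamagawaTwistHolds
import Literature.NumberTheory.EllipticCurves.TwoAdicImageSurjectivityModTwoProofs
import HarnessLib

/-!
# Route `GenusKolyvaginAtTwo`, supply cruxes 25504 (`Δ > 0`) / 23491 (`Δ < 0`) at DEPTH ZERO: Kriz–Li's Assumption (★) as a per-pair
# CERTIFICATE — on a (★)-certified pair with a minimal rank-one twin the supply's whole output tuple is exhibited with `M₀ = 0`, `n = 1`

Seat `bsd-line-gk2-p2` g24 (PROVER 2/3, cell `bsd-f1-sign2`; LINE 23 holder; sequel of `…MinimalTwinBSDTwoSwappedPairStarCertificate.lean`),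
`--supports stmt-BirchSwinnertonDyer-25504 --as helper` (helper; closes nothing).  THEOREMS ONLY (no definition, no named fact, no `sorry`);
standard axioms; UNCONDITIONAL (no named fact is consumed: the twin's analytic rank `1` and `#Sel₂ = 2` enter as displayed per-curve inputs, exactly
as the supply cruxes state them).  **BSD is NOT proved by this file; the supply cruxes are NOT proved; no item is closed.**

WHAT.  The supply cruxes `GenusPrimitiveSupplyAtTwoPosDiscShallow` (25504) and `GenusDeepSupplyAtTwoNegDiscNarrow` (23491) ask, for a habitat curve
`E`, for SOME Kolyvagin-(H2)-admissible Heegner field `K`, an optimal odd-Manin frame, `y_K` of infinite order with its exponent `M₀`, a DEEP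
`2`-primitive witness `(n, d)`, and a globally minimal rank-`1` twin with `#Sel₂ = 2` in the sign's Tamagawa budget.  On the `#Sel₂(E) = 1` cells
K₁/K₁⁺ force `M₀ = 0`, and then the witness clause is met by `n = 1`, `d = d₁` (empty product of Kolyvagin primes; `P(1) ∉ 2E(K[1])`).  Kriz–Li's
Assumption (★) for the pair `(E, K)` (FMS 2019 §4; tree `KrizLi2019.AssumptionStar`; per pair a finite `2`-adic computation) DELIVERS `M₀ = 0` and
`y_K` of infinite order (their Lemma 5.4, first step — PROVED in the tree, `KrizLi2019.not_exists_two_zsmul_eq_of_assumptionStar` /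
`…not_isOfFinAddOrder_of_assumptionStar`; McCallum 5.1 descent to `E(K[1])`).  Hence:

* §1 `not_twoDiv_and_not_isOfFinAddOrder_of_assumptionStar_habitat` — habitat `E` (`ρ̄_{E,2}` onto, `C(E)` odd), `K` odd-`d_K` Heegner, odd-`c`
  datum, `P₀` under `P(1)`, `j` with (★): `P(1)` has infinite order, `2^0 ∣ P(1)`, `2^1 ∤ P(1)`, and `¬ ∃ Q, 2 • Q = P(1)`.
* §2 **`posDiscShallowSupply_witness_of_assumptionStar`** — for `E` with `Δ > 0` and ANY `K` with the crux's side conditions carrying a (★)-certified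
  optimal odd-Manin frame and a globally minimal twin `Wd` (non-CM is derived) with `r_an(Wd) = 1`, `#Sel₂(Wd) = 2`, `ord₂ C(Wd) = 0`: the ENTIRE
  existential conclusion of `GenusPrimitiveSupplyAtTwoPosDiscShallow` for this `E`, VERBATIM, with `M₀ = 0`, `n = 1`, `d = d₁`.
* §3 **`negDiscNarrowSupply_witness_of_assumptionStar`** — the same for `Δ < 0` and `GenusDeepSupplyAtTwoNegDiscNarrow` (`ord₂ C(Wd) ≤ 1`).

READING.  On the (★)-locus the supply cruxes at depth zero are CERTIFICATE-SHAPED: exhibiting `(K, (★), a minimal rank-one twin in budget)` per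
curve discharges them there — no Chebotarev, no deep prime, no Kolyvagin-system input.  ((★) never holds on the `#Sel₂(E) = 4` cells: it forces
`M₀ = 0`, while there BSD forces `M₀ ≥ 1` — so this says nothing about K₄/K₄⁺.)  Companion: `…SwappedPairStarCertificate.lean` (K₁ at (★)-frames;
U₂ on the (★)-locus from the wall).  BSD is NOT proved by any of this.

References: [KrizLi2019] FMS Thm. 1.12, §4 (★), Lemma 5.4, Rem. 1.14; [McCallumLMS1991] §5 Lemma 5.1; [GrossLMS1991] §3; [SilvermanAEC2009]
Cor. VII.6.2.
-/

set_option autoImplicit false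
set_option linter.dupNamespace false -- `Summit.<P>.<Sub>` repeats `BirchSwinnertonDyer` (D-0017)

noncomputable section

open scoped Classical

open WeierstrassCurve NumberField Literature.NumberTheory.EllipticCurves
  Literature.NumberTheory.EllipticCurves.ModularForms
  Literature.NumberTheory.EllipticCurves.Rank1Residual
  Literature.NumberTheory.EllipticCurves.KrizLi2019
  Summit.BirchSwinnertonDyer.Rank1Residual
  Summit.BirchSwinnertonDyer.BirchSwinnertonDyer.Theses.GenusKolyvaginAtTwo
  Summit.BirchSwinnertonDyer.BirchSwinnertonDyer.Theorems.CMExactDescent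
  Summit.BirchSwinnertonDyer.BirchSwinnertonDyer.Theorems.GenusExact.TwinSwap

namespace Summit.BirchSwinnertonDyer.BirchSwinnertonDyer.Theorems.GenusKoly.Star

/-! ## §1 (★) on a habitat frame -/

/-- **(★) on a habitat frame ⟹ `P(1)` of infinite order, `2^0 ∣ P(1)`, `2^1 ∤ P(1)` and `P(1) ∉ 2E(K[1])`.**  `W/ℚ` globally minimal with
`ρ̄_{E,2}` onto and `C(E)` odd (so `E(ℚ)[2] = 0` and `c₂(E)` odd); `K` imaginary quadratic with odd `d_K`, Heegner; a datum `Dt` with odd `Dt.c`;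
`d₁` of conductor `1`; `P₀ ∈ E(K)` under `P(1)`; `j : K → ℚ₂` with `AssumptionStar W Dt K P₀ j`.  Kriz–Li Lemma 5.4 (first step, tree theorems) and
McCallum's Lemma 5.1 descent (`E(K[1])` has no `2`-torsion). [cite: KrizLi2019, Lemma 5.4 (FMS), proof] [cite: McCallumLMS1991, §5 Lemma 5.1]
[cite: SilvermanAEC2009, Cor. VII.6.2] -/
theorem not_twoDiv_and_not_isOfFinAddOrder_of_assumptionStar_habitat
    (W : WeierstrassCurve ℚ) [W.IsElliptic] [W.IsGloballyMinimal] [NeZero (W.conductorNorm ℤ)]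
    (hρ2 : W.HasSurjectiveModNGaloisRep 2) (hT : Odd W.tamagawaProduct)
    (K : Type) [Field K] [NumberField K] (hIQ : IsImaginaryQuadratic K) (hodd : Odd (NumberField.discr K))
    (hHe : SatisfiesHeegnerHypothesis (W.conductorNorm ℤ) K)
    (Dt : ModularParametrizationData W (W.conductorNorm ℤ)) (hc : Odd Dt.c) (β : ℤ) (ι : K →+* ℂ)
    (d₁ : KolyvaginHeegnerData Dt β ι 1) (P₀ : (W.baseChange K).toAffine.Point)
    (hP₀K : WeierstrassCurve.Affine.Point.map (W' := W) (algebraMap K (ringClassField K ι 1)).toRatAlgHom P₀ = d₁.derivedPoint)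
    (j : K →ₐ[ℚ] ℚ_[2]) (hstar : AssumptionStar W Dt K P₀ j) :
    ¬ IsOfFinAddOrder d₁.derivedPoint ∧
      (∃ Q : (W.baseChange (ringClassField K ι 1)).toAffine.Point, ((2 ^ 0 : ℕ) : ℤ) • Q = d₁.derivedPoint) ∧
      (¬ ∃ Q : (W.baseChange (ringClassField K ι 1)).toAffine.Point, ((2 ^ (0 + 1) : ℕ) : ℤ) • Q = d₁.derivedPoint) ∧
      ¬ ∃ Q : (W.baseChange (ringClassField K ι 1)).toAffine.Point, (2 : ℤ) • Q = d₁.derivedPoint := by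
  haveI : Fact (Nat.Prime 2) := ⟨Nat.prime_two⟩
  have hc2 : Odd ((W.baseChange ℚ_[2]).localTamagawaNumber ℤ_[2]) :=
    hT.of_dvd_nat (BoxerDiao2010.localTamagawaNumber_padic_dvd_tamagawaProduct W 2)
  have hy : ¬ IsOfFinAddOrder d₁.derivedPoint := by
    intro hfin
    apply not_isOfFinAddOrder_of_assumptionStar W Dt K P₀ j hstar hc2 hc
    rw [← hP₀K] at hfin
    exact (WeierstrassCurve.Affine.Point.map_injective (W' := W) _).isOfFinAddOrder_iff.mp hfin
  have h2 : ¬ ∃ Q : (W.baseChange (ringClassField K ι 1)).toAffine.Point, (2 : ℤ) • Q = d₁.derivedPoint := by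
    rintro ⟨Q, hQ⟩
    have htor1 : ∀ R : (W.baseChange (ringClassField K ι 1)).toAffine.Point, ((2 ^ 1 : ℕ) : ℤ) • R = 0 → R = 0 :=
      fun R hR ↦ eq_zero_of_two_pow_smul_eq_zero_ringClassField W hIQ hodd hHe hρ2 ι 1 R hR
    have hdiv : X11b.Three.Koly.PDiv d₁ 2 1 := ⟨Q, by rw [pow_one, Nat.cast_ofNat]; exact hQ⟩
    obtain ⟨Q₀, hQ₀⟩ := (X11b.Three.Koly.pDiv_one_iff_exists_zsmul_eq hIQ d₁ P₀ hP₀K 2 1 htor1).mp hdiv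
    exact not_exists_two_zsmul_eq_of_assumptionStar W Dt K P₀ j hstar hc2 hc ⟨Q₀, by rw [← hQ₀, pow_one, Nat.cast_ofNat]⟩
  refine ⟨hy, ⟨d₁.derivedPoint, by rw [pow_zero, Nat.cast_one, one_smul]⟩, ?_, h2⟩
  rintro ⟨Q, hQ⟩
  exact h2 ⟨Q, by rw [← hQ, zero_add, pow_one, Nat.cast_ofNat]⟩

/-! ## §2 The `Δ > 0` shallow supply (25504) at a (★)-certified depth-zero pair -/

/-- **The whole output of `GenusPrimitiveSupplyAtTwoPosDiscShallow` (25504) for `E`, from a (★)-certified pair.**  `W/ℚ` globally minimal,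
non-CM, with `ρ̄_{E,2}` onto and `C(E)` odd; `K` imaginary quadratic, odd `d_K ≠ −3`, Heegner, the two non-square side conditions; an OPTIMAL datum
`Dt` (lattice clause `hopt`) with odd `Dt.c`; `β`, `ι`, `d₁`; `P₀ ∈ E(K)` under `P(1)` and `j` with (★); a globally minimal model `Wd` of `E^(d_K)` with
`r_an(Wd) = 1`, `#Sel₂(Wd) = 2`, `ord₂ C(Wd) = 0`.  Then the crux's existential conclusion holds VERBATIM with `M₀ = 0` and the witness `n = 1`,
`d = d₁` (no Kolyvagin prime: the `∀ ℓ ∈ (1).primeFactors` clause is empty, and `P(1) ∉ 2E(K[1])` by §1).  UNCONDITIONAL; the analytic-rank and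
Selmer inputs of the twin are displayed exactly as the crux states them. [cite: KrizLi2019, Lemma 5.4 (FMS), proof] [cite: McCallumLMS1991, §5 Lemma 5.1] -/
theorem posDiscShallowSupply_witness_of_assumptionStar
    (W : WeierstrassCurve ℚ) [W.IsElliptic] [W.IsGloballyMinimal] [NeZero (W.conductorNorm ℤ)]
    (hcm : ¬ W.HasCM) (hρ2 : W.HasSurjectiveModNGaloisRep 2) (hT : Odd W.tamagawaProduct)
    (K : Type) [Field K] [NumberField K] (hIQ : IsImaginaryQuadratic K) (hodd : Odd (NumberField.discr K))
    (h3 : NumberField.discr K ≠ -3) (hHe : SatisfiesHeegnerHypothesis (W.conductorNorm ℤ) K)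
    (hsq1 : ¬ IsSquare ((NumberField.discr K : ℚ) * -|W.Δ|)) (hsq2 : ¬ IsSquare ((NumberField.discr K : ℚ) * (-(2 * |W.Δ|))))
    (Dt : ModularParametrizationData W (W.conductorNorm ℤ))
    (hopt : ∀ z ∈ Dt.L.lattice, ∃ w ∈ periodLattice Dt.f, z = (Dt.c : ℂ) * w) (hc : Odd Dt.c)
    (β : ℤ) (ι : K →+* ℂ) (d₁ : KolyvaginHeegnerData Dt β ι 1) (P₀ : (W.baseChange K).toAffine.Point)
    (hP₀K : WeierstrassCurve.Affine.Point.map (W' := W) (algebraMap K (ringClassField K ι 1)).toRatAlgHom P₀ = d₁.derivedPoint)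
    (j : K →ₐ[ℚ] ℚ_[2]) (hstar : AssumptionStar W Dt K P₀ j)
    (Wd : WeierstrassCurve ℚ) [Wd.IsElliptic] [Wd.IsGloballyMinimal]
    (hWd : ∃ C : VariableChange ℚ, C • W.quadraticTwist (NumberField.discr K : ℚ) = Wd)
    (hrd : Wd.analyticRank = 1) (hSel : Nat.card (Wd.selmerGroup 2) = 2) (hTam : padicValNat 2 Wd.tamagawaProduct = 0) :
    ∃ (K : Type) (_ : Field K) (_ : NumberField K), IsImaginaryQuadratic K ∧ Odd (NumberField.discr K) ∧ NumberField.discr K ≠ -3 ∧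
      SatisfiesHeegnerHypothesis (W.conductorNorm ℤ) K ∧ ¬ IsSquare ((NumberField.discr K : ℚ) * -|W.Δ|) ∧
      ¬ IsSquare ((NumberField.discr K : ℚ) * (-(2 * |W.Δ|))) ∧
      ∃ (Dt : ModularParametrizationData W (W.conductorNorm ℤ)) (β : ℤ) (ι : K →+* ℂ) (d₁ : KolyvaginHeegnerData Dt β ι 1),
        (∀ z ∈ Dt.L.lattice, ∃ w ∈ periodLattice Dt.f, z = (Dt.c : ℂ) * w) ∧ Odd Dt.c ∧ ¬ IsOfFinAddOrder d₁.derivedPoint ∧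
        ∃ M₀ : ℕ, (∃ Q : (W.baseChange (ringClassField K ι 1)).toAffine.Point, ((2 ^ M₀ : ℕ) : ℤ) • Q = d₁.derivedPoint) ∧
          (¬ ∃ Q : (W.baseChange (ringClassField K ι 1)).toAffine.Point, ((2 ^ (M₀ + 1) : ℕ) : ℤ) • Q = d₁.derivedPoint) ∧
          ∃ (n : ℕ) (d : KolyvaginHeegnerData Dt β ι n), Squarefree n ∧
            (∀ ℓ ∈ n.primeFactors, Zhang2014.IsKolyvaginPrime (W.conductorNorm ℤ) W K 2 ℓ ∧ 2 ≤ Zhang2014.kolyvaginIndex W 2 ℓ ∧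
              ∃ (v : IsDedekindDomain.HeightOneSpectrum (NumberField.RingOfIntegers ℚ))
                (𝔓 : Ideal (Literature.NumberTheory.GaloisRepresentations.absIntegers (NumberField.RingOfIntegers ℚ) ℚ))
                (h : Field.absoluteGaloisGroup ℚ), ((ℓ : ℕ) : NumberField.RingOfIntegers ℚ) ∈ v.asIdeal ∧ 𝔓 ∈ v.primesAbove ∧
                  IsArithFrobAt (NumberField.RingOfIntegers ℚ) h 𝔓 ∧ ∃ u : W.geomTorsion ((2 : ℕ) : ℤ), h • u ≠ u) ∧
            (¬ ∃ Q : (W.baseChange (ringClassField K ι n)).toAffine.Point, (2 : ℤ) • Q = d.derivedPoint) ∧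
            ∃ (Wd : WeierstrassCurve ℚ) (_ : Wd.IsElliptic) (_ : Wd.IsGloballyMinimal),
              (∃ C : VariableChange ℚ, C • W.quadraticTwist (NumberField.discr K : ℚ) = Wd) ∧ ¬ Wd.HasCM ∧ Wd.analyticRank = 1 ∧
                Nat.card (Wd.selmerGroup 2) = 2 ∧ padicValNat 2 Wd.tamagawaProduct = 0 := by
  obtain ⟨hy, hdiv, hndiv, -⟩ := not_twoDiv_and_not_isOfFinAddOrder_of_assumptionStar_habitat W hρ2 hT K hIQ hodd hHe Dt hc β ι d₁ P₀
    hP₀K j hstar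
  have hd : (NumberField.discr K : ℚ) ≠ 0 := by exact_mod_cast NumberField.discr_ne_zero K
  have hcmd : ¬ Wd.HasCM := GenusKoly.twin_not_hasCM W hcm hd Wd hWd
  -- the witness at depth zero: `n = 1`, `d = d₁` (LEAD gk2-p1's `GenusSupplyNarrow.exists_deepWitness_of_depth_zero`)
  obtain ⟨n, d, hn, hKoly, hPn⟩ := GenusSupplyNarrow.exists_deepWitness_of_depth_zero W Dt β ι d₁
    (fun ℓ ↦ Zhang2014.IsKolyvaginPrime (W.conductorNorm ℤ) W K 2 ℓ ∧ 2 ≤ Zhang2014.kolyvaginIndex W 2 ℓ ∧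
      ∃ (v : IsDedekindDomain.HeightOneSpectrum (NumberField.RingOfIntegers ℚ))
        (𝔓 : Ideal (Literature.NumberTheory.GaloisRepresentations.absIntegers (NumberField.RingOfIntegers ℚ) ℚ))
        (h : Field.absoluteGaloisGroup ℚ), ((ℓ : ℕ) : NumberField.RingOfIntegers ℚ) ∈ v.asIdeal ∧ 𝔓 ∈ v.primesAbove ∧
          IsArithFrobAt (NumberField.RingOfIntegers ℚ) h 𝔓 ∧ ∃ u : W.geomTorsion ((2 : ℕ) : ℤ), h • u ≠ u) hndiv
  exact ⟨K, inferInstance, inferInstance, hIQ, hodd, h3, hHe, hsq1, hsq2, Dt, β, ι, d₁, hopt, hc, hy, 0, hdiv, hndiv, n, d, hn, hKoly, hPn,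
    Wd, inferInstance, inferInstance, hWd, hcmd, hrd, hSel, hTam⟩

/-! ## §3 The `Δ < 0` narrow supply (23491) at a (★)-certified depth-zero pair -/

/-- **The whole output of `GenusDeepSupplyAtTwoNegDiscNarrow` (23491) for `E`, from a (★)-certified pair** — as §2 with the `Δ < 0` currencies:
the deep clause `FrobEqFrobInfty` is again empty at `n = 1`, and the twin's budget is `ord₂ C(Wd) ≤ 1`.  UNCONDITIONAL.
[cite: KrizLi2019, Lemma 5.4 (FMS), proof] [cite: McCallumLMS1991, §5 Lemma 5.1] -/
theorem negDiscNarrowSupply_witness_of_assumptionStar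
    (W : WeierstrassCurve ℚ) [W.IsElliptic] [W.IsGloballyMinimal] [NeZero (W.conductorNorm ℤ)]
    (hcm : ¬ W.HasCM) (hρ2 : W.HasSurjectiveModNGaloisRep 2) (hT : Odd W.tamagawaProduct)
    (K : Type) [Field K] [NumberField K] (hIQ : IsImaginaryQuadratic K) (hodd : Odd (NumberField.discr K))
    (h3 : NumberField.discr K ≠ -3) (hHe : SatisfiesHeegnerHypothesis (W.conductorNorm ℤ) K)
    (hsq1 : ¬ IsSquare ((NumberField.discr K : ℚ) * -|W.Δ|)) (hsq2 : ¬ IsSquare ((NumberField.discr K : ℚ) * (-(2 * |W.Δ|))))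
    (Dt : ModularParametrizationData W (W.conductorNorm ℤ))
    (hopt : ∀ z ∈ Dt.L.lattice, ∃ w ∈ periodLattice Dt.f, z = (Dt.c : ℂ) * w) (hc : Odd Dt.c)
    (β : ℤ) (ι : K →+* ℂ) (d₁ : KolyvaginHeegnerData Dt β ι 1) (P₀ : (W.baseChange K).toAffine.Point)
    (hP₀K : WeierstrassCurve.Affine.Point.map (W' := W) (algebraMap K (ringClassField K ι 1)).toRatAlgHom P₀ = d₁.derivedPoint)
    (j : K →ₐ[ℚ] ℚ_[2]) (hstar : AssumptionStar W Dt K P₀ j)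
    (Wd : WeierstrassCurve ℚ) [Wd.IsElliptic] [Wd.IsGloballyMinimal]
    (hWd : ∃ C : VariableChange ℚ, C • W.quadraticTwist (NumberField.discr K : ℚ) = Wd)
    (hrd : Wd.analyticRank = 1) (hSel : Nat.card (Wd.selmerGroup 2) = 2) (hDEF : padicValNat 2 Wd.tamagawaProduct ≤ 1) :
    ∃ (K : Type) (_ : Field K) (_ : NumberField K), IsImaginaryQuadratic K ∧ Odd (NumberField.discr K) ∧ NumberField.discr K ≠ -3 ∧
      SatisfiesHeegnerHypothesis (W.conductorNorm ℤ) K ∧ ¬ IsSquare ((NumberField.discr K : ℚ) * -|W.Δ|) ∧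
      ¬ IsSquare ((NumberField.discr K : ℚ) * (-(2 * |W.Δ|))) ∧
      ∃ (Dt : ModularParametrizationData W (W.conductorNorm ℤ)) (β : ℤ) (ι : K →+* ℂ) (d₁ : KolyvaginHeegnerData Dt β ι 1),
        (∀ z ∈ Dt.L.lattice, ∃ w ∈ periodLattice Dt.f, z = (Dt.c : ℂ) * w) ∧ Odd Dt.c ∧ ¬ IsOfFinAddOrder d₁.derivedPoint ∧
        ∃ M₀ : ℕ, (∃ Q : (W.baseChange (ringClassField K ι 1)).toAffine.Point, ((2 ^ M₀ : ℕ) : ℤ) • Q = d₁.derivedPoint) ∧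
          (¬ ∃ Q : (W.baseChange (ringClassField K ι 1)).toAffine.Point, ((2 ^ (M₀ + 1) : ℕ) : ℤ) • Q = d₁.derivedPoint) ∧
          ∃ (n : ℕ) (d : KolyvaginHeegnerData Dt β ι n), Squarefree n ∧
            (∀ ℓ ∈ n.primeFactors, Zhang2014.IsKolyvaginPrime (W.conductorNorm ℤ) W K 2 ℓ ∧ 2 ≤ Zhang2014.kolyvaginIndex W 2 ℓ ∧
              FrobEqFrobInfty W K 2 ℓ) ∧
            (¬ ∃ Q : (W.baseChange (ringClassField K ι n)).toAffine.Point, (2 : ℤ) • Q = d.derivedPoint) ∧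
            ∃ (Wd : WeierstrassCurve ℚ) (_ : Wd.IsElliptic) (_ : Wd.IsGloballyMinimal),
              (∃ C : VariableChange ℚ, C • W.quadraticTwist (NumberField.discr K : ℚ) = Wd) ∧ ¬ Wd.HasCM ∧ Wd.analyticRank = 1 ∧
                Nat.card (Wd.selmerGroup 2) = 2 ∧ padicValNat 2 Wd.tamagawaProduct ≤ 1 := by
  obtain ⟨hy, hdiv, hndiv, -⟩ := not_twoDiv_and_not_isOfFinAddOrder_of_assumptionStar_habitat W hρ2 hT K hIQ hodd hHe Dt hc β ι d₁ P₀
    hP₀K j hstar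
  have hd : (NumberField.discr K : ℚ) ≠ 0 := by exact_mod_cast NumberField.discr_ne_zero K
  have hcmd : ¬ Wd.HasCM := GenusKoly.twin_not_hasCM W hcm hd Wd hWd
  obtain ⟨n, d, hn, hKoly, hPn⟩ := GenusSupplyNarrow.exists_deepWitness_of_depth_zero W Dt β ι d₁
    (fun ℓ ↦ Zhang2014.IsKolyvaginPrime (W.conductorNorm ℤ) W K 2 ℓ ∧ 2 ≤ Zhang2014.kolyvaginIndex W 2 ℓ ∧ FrobEqFrobInfty W K 2 ℓ) hndiv
  exact ⟨K, inferInstance, inferInstance, hIQ, hodd, h3, hHe, hsq1, hsq2, Dt, β, ι, d₁, hopt, hc, hy, 0, hdiv, hndiv, n, d, hn, hKoly, hPn,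
    Wd, inferInstance, inferInstance, hWd, hcmd, hrd, hSel, hDEF⟩

/-- **The supply crux 25504 AT A (★)-CERTIFIED CURVE, in the crux's own ∀-shape**: for `E` in the habitat with `Δ > 0` and the shallow
Selmer hypothesis, IF a (★)-certified optimal odd-Manin pair `(K, …)` with a minimal rank-one twin of odd Tamagawa product is exhibited, the
crux's conclusion for `E` follows (§2) — the `2`-adic tower, `r_an(E) = 0` and the Selmer disjunction are idle.  Bookkeeping; UNCONDITIONAL;
closes nothing (the crux quantifies over every habitat curve). [cite: KrizLi2019, Lemma 5.4 (FMS), proof] -/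
theorem genusPrimitiveSupplyAtTwoPosDiscShallow_at_of_assumptionStar
    (W : WeierstrassCurve ℚ) [W.IsElliptic] [W.IsGloballyMinimal] [NeZero (W.conductorNorm ℤ)]
    (hcm : ¬ W.HasCM) (hρ : ∀ n : ℕ, 0 < n → W.HasSurjectiveModNGaloisRep ((2 : ℤ) ^ n)) (hT : Odd W.tamagawaProduct)
    (hcert : ∃ (K : Type) (_ : Field K) (_ : NumberField K), IsImaginaryQuadratic K ∧ Odd (NumberField.discr K) ∧
      NumberField.discr K ≠ -3 ∧ SatisfiesHeegnerHypothesis (W.conductorNorm ℤ) K ∧ ¬ IsSquare ((NumberField.discr K : ℚ) * -|W.Δ|) ∧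
      ¬ IsSquare ((NumberField.discr K : ℚ) * (-(2 * |W.Δ|))) ∧
      ∃ (Dt : ModularParametrizationData W (W.conductorNorm ℤ)) (β : ℤ) (ι : K →+* ℂ) (d₁ : KolyvaginHeegnerData Dt β ι 1)
        (P₀ : (W.baseChange K).toAffine.Point) (j : K →ₐ[ℚ] ℚ_[2]),
        (∀ z ∈ Dt.L.lattice, ∃ w ∈ periodLattice Dt.f, z = (Dt.c : ℂ) * w) ∧ Odd Dt.c ∧
        WeierstrassCurve.Affine.Point.map (W' := W) (algebraMap K (ringClassField K ι 1)).toRatAlgHom P₀ = d₁.derivedPoint ∧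
        AssumptionStar W Dt K P₀ j ∧
        ∃ (Wd : WeierstrassCurve ℚ) (_ : Wd.IsElliptic) (_ : Wd.IsGloballyMinimal),
          (∃ C : VariableChange ℚ, C • W.quadraticTwist (NumberField.discr K : ℚ) = Wd) ∧ Wd.analyticRank = 1 ∧
          Nat.card (Wd.selmerGroup 2) = 2 ∧ padicValNat 2 Wd.tamagawaProduct = 0) :
    ∃ (K : Type) (_ : Field K) (_ : NumberField K), IsImaginaryQuadratic K ∧ Odd (NumberField.discr K) ∧ NumberField.discr K ≠ -3 ∧
      SatisfiesHeegnerHypothesis (W.conductorNorm ℤ) K ∧ ¬ IsSquare ((NumberField.discr K : ℚ) * -|W.Δ|) ∧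
      ¬ IsSquare ((NumberField.discr K : ℚ) * (-(2 * |W.Δ|))) ∧
      ∃ (Dt : ModularParametrizationData W (W.conductorNorm ℤ)) (β : ℤ) (ι : K →+* ℂ) (d₁ : KolyvaginHeegnerData Dt β ι 1),
        (∀ z ∈ Dt.L.lattice, ∃ w ∈ periodLattice Dt.f, z = (Dt.c : ℂ) * w) ∧ Odd Dt.c ∧ ¬ IsOfFinAddOrder d₁.derivedPoint ∧
        ∃ M₀ : ℕ, (∃ Q : (W.baseChange (ringClassField K ι 1)).toAffine.Point, ((2 ^ M₀ : ℕ) : ℤ) • Q = d₁.derivedPoint) ∧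
          (¬ ∃ Q : (W.baseChange (ringClassField K ι 1)).toAffine.Point, ((2 ^ (M₀ + 1) : ℕ) : ℤ) • Q = d₁.derivedPoint) ∧
          ∃ (n : ℕ) (d : KolyvaginHeegnerData Dt β ι n), Squarefree n ∧
            (∀ ℓ ∈ n.primeFactors, Zhang2014.IsKolyvaginPrime (W.conductorNorm ℤ) W K 2 ℓ ∧ 2 ≤ Zhang2014.kolyvaginIndex W 2 ℓ ∧
              ∃ (v : IsDedekindDomain.HeightOneSpectrum (NumberField.RingOfIntegers ℚ))
                (𝔓 : Ideal (Literature.NumberTheory.GaloisRepresentations.absIntegers (NumberField.RingOfIntegers ℚ) ℚ))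
                (h : Field.absoluteGaloisGroup ℚ), ((ℓ : ℕ) : NumberField.RingOfIntegers ℚ) ∈ v.asIdeal ∧ 𝔓 ∈ v.primesAbove ∧
                  IsArithFrobAt (NumberField.RingOfIntegers ℚ) h 𝔓 ∧ ∃ u : W.geomTorsion ((2 : ℕ) : ℤ), h • u ≠ u) ∧
            (¬ ∃ Q : (W.baseChange (ringClassField K ι n)).toAffine.Point, (2 : ℤ) • Q = d.derivedPoint) ∧
            ∃ (Wd : WeierstrassCurve ℚ) (_ : Wd.IsElliptic) (_ : Wd.IsGloballyMinimal),
              (∃ C : VariableChange ℚ, C • W.quadraticTwist (NumberField.discr K : ℚ) = Wd) ∧ ¬ Wd.HasCM ∧ Wd.analyticRank = 1 ∧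
                Nat.card (Wd.selmerGroup 2) = 2 ∧ padicValNat 2 Wd.tamagawaProduct = 0 := by
  obtain ⟨K, _, _, hIQ, hodd, h3, hHe, hsq1, hsq2, Dt, β, ι, d₁, P₀, j, hopt, hc, hP₀K, hstar, Wd, _, _, hWd, hrd, hSel, hTam⟩ := hcert
  exact posDiscShallowSupply_witness_of_assumptionStar W hcm (by simpa using hρ 1 one_pos) hT K hIQ hodd h3 hHe hsq1 hsq2 Dt hopt hc β ι d₁
    P₀ hP₀K j hstar Wd hWd hrd hSel hTam

end Summit.BirchSwinnertonDyer.BirchSwinnertonDyer.Theorems.GenusKoly.Star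

end
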